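import Literature.Geometry.Lorentzian.PartialVelocityLift
import Literature.Geometry.Lorentzian.TwoParameterCurvature
import Literature.Geometry.Lorentzian.GaussEquationFrame
import Literature.Geometry.Lorentzian.HypersurfaceRestriction
import Literature.Geometry.Lorentzian.InverseMeanCurvatureFlowArea
import Literature.Geometry.Riemannian.JacobiVariation
import Literature.Geometry.Riemannian.ConstantCurvatureJacobi
import HarnessLib

/-!
# First and second variation of the level hypersurfaces of a one-parameter family of maps
# (O'Neill 1983, Ch. 4, Prop. 44; Ch. 8, Lemma 8.3; Bär–Gauduchon–Moroianu 2005, §4)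

Topic `Literature/Geometry/Riemannian`. A brick of the proof programme of
`Literature.Geometry.Riemannian.BaerHankePscGluing` (Bär–Hanke 2023, §3, (8)–(9)): the variation
formulas behind `II_t = -½ ġ_t` and the Riccati equation for the hypersurfaces `N_t`, written for
an ABSTRACT family `F : N × ℝ → M` of maps of a manifold `N` into a pseudo-Riemannian manifold
`(M, g)` which is `C^∞` near `(z, t)`; the level maps are `F_t = F(·, t) : N → M` and the
*variation field* is `T_t(y) = ∂_t F(y, t) ∈ T_{F_t y}M`, a field along `F_t`. Both the normal
exponential map of a hypersurface (`NormalExpVariation.lean`, `F(y, t) = exp(t ν(y))`) and a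
generalized cylinder `(N × ℝ, g_t + dt²)` (`F = id`) are instances.

* `hasDerivAt_val_mfderiv_family` — **first variation**: `τ ↦ g(dF_τ v, dF_τ w)` has derivative
  `g(D_v T_t, dF_t w) + g(D_w T_t, dF_t v)` at `t` (`D_v T_t = normalDerivAlong F_t T_t z v`);
  `hasDerivAt_val_mfderiv_family_eq_secondFundamentalForm` — the same as `K_t(v, w) + K_t(w, v)`
  with `K_t` the second fundamental form of `F_t` w.r.t. `T_t` (O'Neill 1983, Ch. 4, Prop. 44 (1):
  `D_τ ∂_s = D_s ∂_τ`, metric compatibility).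
* `hasDerivAt_secondVariation_family` — **second variation** through the chart-straight curve
  `c_w`: if the `t`-curves `τ ↦ F(y, τ)` are geodesics at time `t` for `y` near `z`, then
  `k(τ) = g(D_s T, S)(τ, 0)` (`x(τ, s) = F(c_w s, τ)`, `T = ∂_τ x`, `S = ∂_s x`) has derivative
  `g(R(T, S)T, S) + g(D_s T, D_s T)` at `t` (curvature identity
  `D_t D_s T - D_s D_t T = R(T, S) T`, `TwoParameterCurvature.lean`, with `D_t T = 0`; symmetry
  lemma; O'Neill 1983, Ch. 8, proof of Lemma 8.3);
  `hasDerivAt_secondFundamentalForm_self_family` — the same for `τ ↦ K_τ(w, w)`: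
  derivative `g(R(T_t z, dF_t w) T_t z, dF_t w) + g(D_w T_t, D_w T_t)`.

Everything is proved; no definitions, no named facts (D-0026).

## References

* B. O'Neill, *Semi-Riemannian geometry* (1983), Ch. 4, Prop. 44; Ch. 8, Lemma 8.3. [ONeill1983]
* C. Bär, P. Gauduchon, A. Moroianu, *Generalized cylinders in semi-Riemannian and spin
  geometry*, Math. Z. 249 (2005), §4 (Prop. 4.1). [folklore]
* C. Bär, B. Hanke, *Boundary conditions for scalar curvature*, arXiv:2012.09127, §3, (8)–(9).
  [BarHanke2023]
-/

noncomputable section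

open Bundle Set Filter Function Metric
open scoped Manifold ContDiff Topology

namespace Literature.Geometry.Riemannian

open Literature.Geometry.Lorentzian
open Literature.Geometry.Lorentzian.PseudoRiemannianMetric

variable {E : Type*} [NormedAddCommGroup E] [NormedSpace ℝ E] {H : Type*} [TopologicalSpace H]
  {I : ModelWithCorners ℝ E H} {M : Type*} [TopologicalSpace M] [ChartedSpace H M]
  [IsManifold I ∞ M] [FiniteDimensional ℝ E] [CompleteSpace E]
  {E' : Type*} [NormedAddCommGroup E'] [NormedSpace ℝ E'] [FiniteDimensional ℝ E']
  {H' : Type*} [TopologicalSpace H']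
  {I' : ModelWithCorners ℝ E' H'} [I'.Boundaryless] {N : Type*} [TopologicalSpace N]
  [ChartedSpace H' N] [IsManifold I' ∞ N]
  {n : ℕ∞ω} [Fact (1 ≤ n)] (g : PseudoRiemannianMetric I n E (TangentSpace I : M → Type _))
  [g.HasLeviCivita] {F : N × ℝ → M} {z : N} {t : ℝ}

/-! ### Regularity of the family near `(z, t)` -/

section Regularity

omit [IsManifold I ∞ M] [FiniteDimensional ℝ E] [CompleteSpace E] [FiniteDimensional ℝ E']
  [I'.Boundaryless] [IsManifold I' ∞ N]

/-- If `F` is `C^∞` at every point near `(z, t)`, then for `τ` near `t` it is `C^∞` at every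
point near `(z, τ)`. [folklore] -/
theorem eventually_eventually_contMDiffAt_family
    (hF : ∀ᶠ q in 𝓝 (z, t), ContMDiffAt (I'.prod 𝓘(ℝ, ℝ)) I ∞ F q) :
    ∀ᶠ τ in 𝓝 t, ∀ᶠ q in 𝓝 (z, τ), ContMDiffAt (I'.prod 𝓘(ℝ, ℝ)) I ∞ F q := by
  obtain ⟨U, hU, hUo, hzU⟩ := eventually_nhds_iff.1 hF
  have hc : Continuous fun τ : ℝ ↦ ((z, τ) : N × ℝ) := continuous_const.prodMk continuous_id
  filter_upwards [hc.continuousAt.preimage_mem_nhds (hUo.mem_nhds hzU)] with τ hτ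
  exact eventually_nhds_iff.2 ⟨U, hU, hUo, hτ⟩

/-- The level map `F_τ` is `C^∞` at `z` for `τ` near `t`. [folklore] -/
theorem eventually_contMDiffAt_level
    (hF : ∀ᶠ q in 𝓝 (z, t), ContMDiffAt (I'.prod 𝓘(ℝ, ℝ)) I ∞ F q) :
    ∀ᶠ τ in 𝓝 t, ContMDiffAt I' I ∞ (fun y : N ↦ F (y, τ)) z := by
  filter_upwards [eventually_eventually_contMDiffAt_family hF] with τ hτ
  have h1 : ContMDiffAt I' (I'.prod 𝓘(ℝ, ℝ)) ∞ (fun y : N ↦ ((y, τ) : N × ℝ)) z :=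
    contMDiffAt_id.prodMk contMDiffAt_const
  exact hτ.self_of_nhds.comp z h1

/-- The level map `F_t` is `C^∞` at `z`. [folklore] -/
theorem contMDiffAt_level (hF : ∀ᶠ q in 𝓝 (z, t), ContMDiffAt (I'.prod 𝓘(ℝ, ℝ)) I ∞ F q) :
    ContMDiffAt I' I ∞ (fun y : N ↦ F (y, t)) z :=
  (eventually_contMDiffAt_level hF).self_of_nhds

end Regularity

/-! ### The two-parameter maps through chart-straight curves -/

omit [IsManifold I ∞ M] [FiniteDimensional ℝ E] [CompleteSpace E] [FiniteDimensional ℝ E'] in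
/-- The two-parameter map `x(τ, s) = F(c s, τ)` through the chart-straight curve `c` of `N` with
`c(0) = z`, `c'(0) = v` is `C^∞` at every `(τ, s)` near `(t, 0)`. [folklore] -/
theorem eventually_contMDiffAt_uncurry_family_curveThrough
    (hF : ∀ᶠ q in 𝓝 (z, t), ContMDiffAt (I'.prod 𝓘(ℝ, ℝ)) I ∞ F q) (v : TangentSpace I' z) :
    ∀ᶠ q : ℝ × ℝ in 𝓝 (t, 0), ContMDiffAt (𝓘(ℝ, ℝ).prod 𝓘(ℝ, ℝ)) I ∞
      (uncurry fun τ s : ℝ ↦ F (curveThrough I' z v s, τ)) q := by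
  set c := curveThrough I' z v with hc
  have hc_ev : ∀ᶠ s in 𝓝 (0 : ℝ), ContMDiffAt 𝓘(ℝ, ℝ) I' ∞ c s := by
    have hcont : Continuous (fun s : ℝ ↦ extChartAt I' z z + s • (show E' from v)) :=
      continuous_const.add (continuous_id.smul continuous_const)
    have h0 : extChartAt I' z z + (0 : ℝ) • (show E' from v) ∈ (extChartAt I' z).target := by
      rw [zero_smul, add_zero]; exact mem_extChartAt_target z
    have hev := hcont.continuousAt.preimage_mem_nhds ((isOpen_extChartAt_target z).mem_nhds h0)
    filter_upwards [hev] with s hs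
    exact contMDiffAt_curveThrough (n := ∞) z v hs
  have hc0 : ContinuousAt c 0 := (contMDiffAt_curveThrough_zero (n := ∞) z v).continuousAt
  have hΨc : ContinuousAt (fun q : ℝ × ℝ ↦ ((c q.2, q.1) : N × ℝ)) (t, 0) :=
    (ContinuousAt.comp (f := (Prod.snd : ℝ × ℝ → ℝ)) (x := (t, (0 : ℝ))) hc0
      continuousAt_snd).prodMk continuousAt_fst
  have hF_ev : ∀ᶠ q : ℝ × ℝ in 𝓝 (t, 0), ContMDiffAt (I'.prod 𝓘(ℝ, ℝ)) I ∞ F (c q.2, q.1) := by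
    refine hΨc.eventually ?_
    show ∀ᶠ p in 𝓝 ((c 0, t) : N × ℝ), ContMDiffAt (I'.prod 𝓘(ℝ, ℝ)) I ∞ F p
    rw [hc, curveThrough_zero]
    exact hF
  have hc_ev' : ∀ᶠ q : ℝ × ℝ in 𝓝 (t, 0), ContMDiffAt 𝓘(ℝ, ℝ) I' ∞ c q.2 :=
    continuousAt_snd.eventually (by simpa using hc_ev)
  filter_upwards [hF_ev, hc_ev'] with q hqF hqc
  have h1 : ContMDiffAt (𝓘(ℝ, ℝ).prod 𝓘(ℝ, ℝ)) (I'.prod 𝓘(ℝ, ℝ)) ∞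
      (fun q : ℝ × ℝ ↦ ((c q.2, q.1) : N × ℝ)) q :=
    (ContMDiffAt.comp q (g := c) (f := Prod.snd) hqc contMDiffAt_snd).prodMk contMDiffAt_fst
  exact hqF.comp q h1

omit [IsManifold I ∞ M] [FiniteDimensional ℝ E] [CompleteSpace E] [FiniteDimensional ℝ E'] in
/-- The two-parameter map `x(τ, s) = F(c s, τ)` is `C²` at `(t, 0)`. [folklore] -/
theorem contMDiffAt_uncurry_family_curveThrough
    (hF : ∀ᶠ q in 𝓝 (z, t), ContMDiffAt (I'.prod 𝓘(ℝ, ℝ)) I ∞ F q) (v : TangentSpace I' z) :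
    ContMDiffAt (𝓘(ℝ, ℝ).prod 𝓘(ℝ, ℝ)) I 2
      (uncurry fun τ s : ℝ ↦ F (curveThrough I' z v s, τ)) (t, 0) :=
  (eventually_contMDiffAt_uncurry_family_curveThrough hF v).self_of_nhds.of_le
    (WithTop.coe_le_coe.2 le_top)

omit [IsManifold I ∞ M] [FiniteDimensional ℝ E] [CompleteSpace E] [FiniteDimensional ℝ E'] in
/-- The `s`-velocity at `s = 0` of `s ↦ F(c s, τ)` is `dF_τ(v)` whenever `F_τ` is `C¹` at `z`
(chain rule and `velocity_curveThrough_zero_holds`). [cite: ONeill1983, Ch. 4, p. 122] -/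
theorem velocity_family_curveThrough {τ : ℝ} (hτ : ContMDiffAt I' I ∞ (fun y : N ↦ F (y, τ)) z)
    (v : TangentSpace I' z) :
    (velocity I (fun s ↦ F (curveThrough I' z v s, τ)) 0 : E) =
      mfderiv I' I (fun y : N ↦ F (y, τ)) z v := by
  have hc : MDifferentiableAt 𝓘(ℝ, ℝ) I' (curveThrough I' z v) 0 :=
    (contMDiffAt_curveThrough_zero (n := 1) z v).mdifferentiableAt one_ne_zero
  have hv : velocity I' (curveThrough I' z v) 0 = v :=
    velocity_curveThrough_zero_holds BoundarylessManifold.isInteriorPoint v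
  have h1 := mfderiv_comp_apply_of_eq (hg := hτ.mdifferentiableAt (by simp)) (hf := hc)
    (hy := curveThrough_zero I' z v) (v := (1 : ℝ))
  exact h1.trans (congrArg (mfderiv I' I (fun y : N ↦ F (y, τ)) z) hv)

omit [FiniteDimensional ℝ E] [CompleteSpace E] [FiniteDimensional ℝ E'] [Fact (1 ≤ n)] in
/-- The variation field `T = ∂_τ x` of `x(τ, s) = F(c s, τ)` has a `C^∞` lift
`(τ, s) ↦ (x(τ, s), T(τ, s)) ∈ TM` at `(t, 0)` (`contMDiffAt_lift_partialVelocity` for the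
family `(s, τ) ↦ x(τ, s)`). [cite: ONeill1983, Ch. 4, p. 122] -/
theorem contMDiffAt_lift_velocity_family_curveThrough
    (hF : ∀ᶠ q in 𝓝 (z, t), ContMDiffAt (I'.prod 𝓘(ℝ, ℝ)) I ∞ F q) (v : TangentSpace I' z) :
    ContMDiffAt (𝓘(ℝ, ℝ).prod 𝓘(ℝ, ℝ)) I.tangent ∞
      (fun q : ℝ × ℝ ↦ (TotalSpace.mk' E (F (curveThrough I' z v q.2, q.1))
        (velocity I (fun τ : ℝ ↦ F (curveThrough I' z v q.2, τ)) q.1) : TangentBundle I M))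
      (t, 0) := by
  set f : ℝ × ℝ → M := fun r ↦ F (curveThrough I' z v r.1, r.2) with hf
  have hswap : ContMDiffAt (𝓘(ℝ, ℝ).prod 𝓘(ℝ, ℝ)) (𝓘(ℝ, ℝ).prod 𝓘(ℝ, ℝ)) ∞
      (fun q : ℝ × ℝ ↦ ((q.2, q.1) : ℝ × ℝ)) (t, 0) := contMDiffAt_snd.prodMk contMDiffAt_fst
  have hf_ev : ∀ᶠ r : ℝ × ℝ in 𝓝 ((0 : ℝ), t), ContMDiffAt (𝓘(ℝ, ℝ).prod 𝓘(ℝ, ℝ)) I ∞ f r := by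
    have h := eventually_contMDiffAt_uncurry_family_curveThrough hF v
    have hc : ContinuousAt (fun r : ℝ × ℝ ↦ ((r.2, r.1) : ℝ × ℝ)) (0, t) :=
      continuousAt_snd.prodMk continuousAt_fst
    filter_upwards [hc.eventually h] with r hr
    have hsw : ContMDiffAt (𝓘(ℝ, ℝ).prod 𝓘(ℝ, ℝ)) (𝓘(ℝ, ℝ).prod 𝓘(ℝ, ℝ)) ∞
        (fun r' : ℝ × ℝ ↦ ((r'.2, r'.1) : ℝ × ℝ)) r := contMDiffAt_snd.prodMk contMDiffAt_fst
    exact ContMDiffAt.comp r (g := uncurry fun τ s : ℝ ↦ F (curveThrough I' z v s, τ))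
      (f := fun r' : ℝ × ℝ ↦ ((r'.2, r'.1) : ℝ × ℝ)) hr hsw
  have hlift := contMDiffAt_lift_partialVelocity (I' := 𝓘(ℝ, ℝ)) (f := f) (y₀ := (0 : ℝ))
    (t₀ := t) hf_ev
  exact hlift.comp (t, 0) hswap

/-! ### First variation of the induced metrics -/

omit [FiniteDimensional ℝ E'] in
/-- **The covariant derivative of the variation field `S`, paired with a tangent vector**:
`g(D_τ S_v(t), dF_t w) = g(D_v T_t, dF_t w)`, where `S_v(τ) = ∂_s|₀ F(c_v(s), τ)` is the variation
field along `τ ↦ F(z, τ)` and `D_v T_t = normalDerivAlong F_t T_t z v` (symmetry lemma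
`D_τ ∂_s = D_s ∂_τ`; `∂_τ F(c s, τ)` IS the field `T_t` along `c`).
[cite: ONeill1983, Ch. 4, Prop. 44 (1)] -/
theorem val_covariantDerivAlong_velocity_family
    (hF : ∀ᶠ q in 𝓝 (z, t), ContMDiffAt (I'.prod 𝓘(ℝ, ℝ)) I ∞ F q) (v w : TangentSpace I' z) :
    g.val (F (z, t))
        (covariantDerivAlong g.leviCivita (fun τ ↦ F (z, τ))
          (fun τ ↦ (velocity I (fun s ↦ F (curveThrough I' z v s, τ)) 0 :
            TangentSpace I (F (z, τ)))) t)
        (mfderiv I' I (fun y : N ↦ F (y, t)) z w) =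
      g.val (F (z, t))
        (g.normalDerivAlong (fun y : N ↦ F (y, t))
          (fun y ↦ velocity I (fun s : ℝ ↦ F (y, s)) t) z v)
        (mfderiv I' I (fun y : N ↦ F (y, t)) z w) := by
  set cov := g.leviCivita with hcov
  set c : ℝ → N := curveThrough I' z v with hc_def
  set f : ℝ → ℝ → M := fun τ s ↦ F (c s, τ) with hf_def
  have hLC := isLeviCivita_leviCivita_holds (g := g)
  have hc0 : c 0 = z := curveThrough_zero I' z v
  have hx : ContMDiffAt (𝓘(ℝ, ℝ).prod 𝓘(ℝ, ℝ)) I 2 (uncurry f) (t, 0) :=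
    contMDiffAt_uncurry_family_curveThrough hF v
  have hbase : (fun τ ↦ f τ 0) = fun τ ↦ F (z, τ) := by
    funext τ
    exact congrArg (fun y ↦ F (y, τ)) hc0
  have hsymm : (covariantDerivAlong cov (fun τ ↦ F (z, τ))
      (fun τ ↦ (velocity I (fun s ↦ f τ s) 0 : TangentSpace I (F (z, τ)))) t : E) =
        covariantDerivAlong cov (fun s ↦ f t s) (fun s ↦ velocity I (fun τ ↦ f τ s) t) 0 := by
    rw [← covariantDerivAlong_congr_base cov hbase (fun τ ↦ (velocity I (fun s ↦ f τ s) 0 : E)) t]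
    exact covariantDerivAlong_velocity_comm cov hLC.1 hx
  show g.val (F (z, t))
      (covariantDerivAlong cov (fun τ ↦ F (z, τ))
        (fun τ ↦ (velocity I (fun s ↦ f τ s) 0 : TangentSpace I (F (z, τ)))) t)
      (mfderiv I' I (fun y : N ↦ F (y, t)) z w) = _
  rw [show (covariantDerivAlong cov (fun τ ↦ F (z, τ))
      (fun τ ↦ (velocity I (fun s ↦ f τ s) 0 : TangentSpace I (F (z, τ)))) t :
        TangentSpace I (F (z, t))) =
      (covariantDerivAlong cov (fun s ↦ f t s) (fun s ↦ velocity I (fun τ ↦ f τ s) t) 0 : E)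
      from hsymm]
  rfl

omit [FiniteDimensional ℝ E'] in
/-- **First variation of the induced metrics of the level maps** (O'Neill 1983, Ch. 4,
Prop. 44 (1); Bär–Hanke 2023, §3, (8)): for `v, w ∈ T_zN` the function `τ ↦ g(dF_τ v, dF_τ w)`
has derivative `g(D_v T_t, dF_t w) + g(D_w T_t, dF_t v)` at `τ = t`.
[cite: ONeill1983, Ch. 4, Prop. 44 (1)] -/
theorem hasDerivAt_val_mfderiv_family
    (hF : ∀ᶠ q in 𝓝 (z, t), ContMDiffAt (I'.prod 𝓘(ℝ, ℝ)) I ∞ F q) (v w : TangentSpace I' z) :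
    HasDerivAt (fun τ ↦ g.val (F (z, τ)) (mfderiv I' I (fun y : N ↦ F (y, τ)) z v)
        (mfderiv I' I (fun y : N ↦ F (y, τ)) z w))
      (g.val (F (z, t))
          (g.normalDerivAlong (fun y : N ↦ F (y, t)) (fun y ↦ velocity I (fun s : ℝ ↦ F (y, s)) t)
            z v) (mfderiv I' I (fun y : N ↦ F (y, t)) z w) +
        g.val (F (z, t))
          (g.normalDerivAlong (fun y : N ↦ F (y, t)) (fun y ↦ velocity I (fun s : ℝ ↦ F (y, s)) t)
            z w) (mfderiv I' I (fun y : N ↦ F (y, t)) z v)) t := by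
  set cov := g.leviCivita with hcov
  have hLC := isLeviCivita_leviCivita_holds (g := g)
  have hev := eventually_contMDiffAt_level hF
  -- the two variation fields, as `E`-valued functions of `τ`
  set Vv : ℝ → E := fun τ ↦ velocity I (fun s ↦ F (curveThrough I' z v s, τ)) 0 with hVv
  set Vw : ℝ → E := fun τ ↦ velocity I (fun s ↦ F (curveThrough I' z w s, τ)) 0 with hVw
  have hbase : ∀ u : TangentSpace I' z,
      (fun τ : ℝ ↦ (fun (τ : ℝ) (s : ℝ) ↦ F (curveThrough I' z u s, τ)) τ 0) =
        fun τ : ℝ ↦ F (z, τ) := by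
    intro u
    funext τ
    exact congrArg (fun y ↦ F (y, τ)) (curveThrough_zero I' z u)
  have hlift : ∀ u : TangentSpace I' z, MDifferentiableAt 𝓘(ℝ, ℝ) I.tangent
      (fun τ ↦ (TotalSpace.mk' E (F (z, τ))
        (velocity I (fun s ↦ F (curveThrough I' z u s, τ)) 0 : E) : TangentBundle I M)) t :=
    fun u ↦ mdifferentiableAt_lift_congr_base (hbase u)
      (mdifferentiableAt_lift_velocity_curry_right (contMDiffAt_uncurry_family_curveThrough hF u))
  have hP := g.hasDerivAt_val_apply_along hLC.2 (γ := fun τ ↦ F (z, τ))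
    (V := fun τ ↦ (Vv τ : TangentSpace I (F (z, τ))))
    (W := fun τ ↦ (Vw τ : TangentSpace I (F (z, τ)))) (hlift v) (hlift w)
  -- near `t` the variation fields are the differentials
  have heq : (fun τ ↦ g.val (F (z, τ)) (Vv τ) (Vw τ)) =ᶠ[𝓝 t] fun τ ↦
      g.val (F (z, τ)) (mfderiv I' I (fun y : N ↦ F (y, τ)) z v)
        (mfderiv I' I (fun y : N ↦ F (y, τ)) z w) := by
    filter_upwards [hev] with τ hτ
    simp only [hVv, hVw]
    rw [velocity_family_curveThrough hτ v, velocity_family_curveThrough hτ w]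
  refine (hP.congr_of_eventuallyEq heq.symm).congr_deriv ?_
  have ht₀ := contMDiffAt_level hF
  have hv₀ : Vv t = mfderiv I' I (fun y : N ↦ F (y, t)) z v := velocity_family_curveThrough ht₀ v
  have hw₀ : Vw t = mfderiv I' I (fun y : N ↦ F (y, t)) z w := velocity_family_curveThrough ht₀ w
  rw [hw₀, hv₀, g.symm (F (z, t)) (mfderiv I' I (fun y : N ↦ F (y, t)) z v)]
  simp only [hVv, hVw]
  rw [val_covariantDerivAlong_velocity_family g hF v w,
    val_covariantDerivAlong_velocity_family g hF w v]

/-- **`ġ_t(v, w) = K_t(v, w) + K_t(w, v)`**: the first variation with its right-hand side written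
through the second fundamental form `K_t` of the level map `F_t` with respect to the variation
field `T_t` (`secondFundamentalForm_apply_holds`; `T_t` is `C^∞` along `F_t` by
`contMDiffAt_lift_partialVelocity_slice`). When `T_t` is a unit normal of `F_t` (Fermi
coordinates, generalized cylinders) `K_t` is symmetric and this reads `ġ_t = 2 K_t`, i.e.
Bär–Hanke's (8) `II_t = -½ ġ_t` with `II_t = -K_t`. [cite: BarHanke2023, §3, (8)] -/
theorem hasDerivAt_val_mfderiv_family_eq_secondFundamentalForm
    (hF : ∀ᶠ q in 𝓝 (z, t), ContMDiffAt (I'.prod 𝓘(ℝ, ℝ)) I ∞ F q) (v w : TangentSpace I' z) :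
    HasDerivAt (fun τ ↦ g.val (F (z, τ)) (mfderiv I' I (fun y : N ↦ F (y, τ)) z v)
        (mfderiv I' I (fun y : N ↦ F (y, τ)) z w))
      (g.secondFundamentalForm I' (fun y : N ↦ F (y, t))
          (fun y ↦ velocity I (fun s : ℝ ↦ F (y, s)) t) z v w +
        g.secondFundamentalForm I' (fun y : N ↦ F (y, t))
          (fun y ↦ velocity I (fun s : ℝ ↦ F (y, s)) t) z w v) t := by
  have hmain := hasDerivAt_val_mfderiv_family g hF v w
  have hdiff : MDifferentiableAt I' I.tangent
      (fun y : N ↦ (TotalSpace.mk' E (F (y, t)) (velocity I (fun s : ℝ ↦ F (y, s)) t) :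
        TangentBundle I M)) z :=
    (contMDiffAt_lift_partialVelocity_slice (f := F) hF).mdifferentiableAt (by simp)
  have happly := fun (a b : TangentSpace I' z) ↦
    g.secondFundamentalForm_apply_holds (I' := I') (y := z) (f := fun y : N ↦ F (y, t))
      (ν := fun y ↦ velocity I (fun s : ℝ ↦ F (y, s)) t)
      BoundarylessManifold.isInteriorPoint hdiff a b
  exact hmain.congr_deriv (by rw [happly v w, happly w v])

omit [CompleteSpace E] [Fact (1 ≤ n)] in
/-- **`K_τ(w, w)` as a pairing along the two-parameter map**: for `τ` near `t`,
`K_τ(w, w) = g(D_s T, S)(τ, 0)` for `x(τ, s) = F(c_w s, τ)` (`secondFundamentalForm_apply_holds`,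
`D_w T_τ = D_s T(τ, 0)` by definition of `normalDerivAlong`, `S(τ, 0) = dF_τ w`).
[cite: ONeill1983, Ch. 4, Lemma 4.4 ff.] -/
theorem eventually_secondFundamentalForm_self_eq_family
    (hF : ∀ᶠ q in 𝓝 (z, t), ContMDiffAt (I'.prod 𝓘(ℝ, ℝ)) I ∞ F q) (w : TangentSpace I' z) :
    ∀ᶠ τ in 𝓝 t, g.secondFundamentalForm I' (fun y : N ↦ F (y, τ))
        (fun y ↦ velocity I (fun s : ℝ ↦ F (y, s)) τ) z w w =
      g.val (F (curveThrough I' z w 0, τ))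
        (covariantDerivAlong g.leviCivita (fun s ↦ F (curveThrough I' z w s, τ))
          (fun s ↦ velocity I (fun τ' : ℝ ↦ F (curveThrough I' z w s, τ')) τ) 0)
        (velocity I (fun s ↦ F (curveThrough I' z w s, τ)) 0) := by
  filter_upwards [eventually_eventually_contMDiffAt_family hF, eventually_contMDiffAt_level hF]
    with τ hτ hτz
  have hdiff : MDifferentiableAt I' I.tangent
      (fun y : N ↦ (TotalSpace.mk' E (F (y, τ)) (velocity I (fun s : ℝ ↦ F (y, s)) τ) :
        TangentBundle I M)) z :=
    (contMDiffAt_lift_partialVelocity_slice (f := F) hτ).mdifferentiableAt (by simp)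
  rw [g.secondFundamentalForm_apply_holds (I' := I') (y := z) (f := fun y : N ↦ F (y, τ))
    (ν := fun y ↦ velocity I (fun s : ℝ ↦ F (y, s)) τ) BoundarylessManifold.isInteriorPoint hdiff w w]
  have hS : (velocity I (fun s ↦ F (curveThrough I' z w s, τ)) 0 : E) =
      mfderiv I' I (fun y : N ↦ F (y, τ)) z w := velocity_family_curveThrough hτz w
  have hp : F (curveThrough I' z w 0, τ) = F (z, τ) := by rw [curveThrough_zero]
  rw [val_congr_point (g := g) hp]
  exact congrArg₂ (fun a b ↦ g.val (F (z, τ)) a b) rfl hS.symm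

/-! ### Second variation along geodesic `t`-curves -/

omit [FiniteDimensional ℝ E'] in
/-- **Second variation** (untraced Riccati identity; O'Neill 1983, Ch. 8, proof of Lemma 8.3):
if the `t`-curves `τ ↦ F(y, τ)` are geodesics at time `t` for `y` near `z` (hypothesis `hgeo`,
`D_t T = 0`), then for `x(τ, s) = F(c_w s, τ)`, `T = ∂_τ x`, `S = ∂_s x`, the function
`k(τ) = g(D_s T, S)(τ, 0)` has derivative `g(R(T, S)T, S)(t, 0) + g(D_s T, D_s T)(t, 0)` at `t`:
product rule, curvature identity `D_t D_s T = D_s D_t T + R(T, S) T`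
(`covariantDerivAlong_covariantDerivAlong_sub_eq_curvature`, `D_s(D_t T) = 0` by locality),
symmetry lemma `D_t S = D_s T`. `hcov₁`: the Levi-Civita connection is locally `C¹`
(`isLocallyContMDiff_leviCivita_holds`). [cite: ONeill1983, Ch. 8, Lemma 8.3 (proof)] -/
theorem hasDerivAt_secondVariation_family (hcov₁ : g.leviCivita.IsLocallyContMDiff 1)
    (hF : ∀ᶠ q in 𝓝 (z, t), ContMDiffAt (I'.prod 𝓘(ℝ, ℝ)) I ∞ F q)
    (hgeo : ∀ᶠ y in 𝓝 z, covariantDerivAlong g.leviCivita (fun τ ↦ F (y, τ))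
      (fun τ ↦ velocity I (fun τ' : ℝ ↦ F (y, τ')) τ) t = 0)
    (w : TangentSpace I' z) :
    HasDerivAt (fun τ ↦ g.val (F (curveThrough I' z w 0, τ))
        (covariantDerivAlong g.leviCivita (fun s ↦ F (curveThrough I' z w s, τ))
          (fun s ↦ velocity I (fun τ' : ℝ ↦ F (curveThrough I' z w s, τ')) τ) 0)
        (velocity I (fun s ↦ F (curveThrough I' z w s, τ)) 0))
      (g.val (F (curveThrough I' z w 0, t))
          (g.leviCivita.curvature (F (curveThrough I' z w 0, t))
            (velocity I (fun τ' : ℝ ↦ F (curveThrough I' z w 0, τ')) t)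
            (velocity I (fun s ↦ F (curveThrough I' z w s, t)) 0)
            (velocity I (fun τ' : ℝ ↦ F (curveThrough I' z w 0, τ')) t))
          (velocity I (fun s ↦ F (curveThrough I' z w s, t)) 0) +
        g.val (F (curveThrough I' z w 0, t))
          (covariantDerivAlong g.leviCivita (fun s ↦ F (curveThrough I' z w s, t))
            (fun s ↦ velocity I (fun τ' : ℝ ↦ F (curveThrough I' z w s, τ')) t) 0)
          (covariantDerivAlong g.leviCivita (fun s ↦ F (curveThrough I' z w s, t))
            (fun s ↦ velocity I (fun τ' : ℝ ↦ F (curveThrough I' z w s, τ')) t) 0)) t := by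
  set cov := g.leviCivita with hcov
  have hLC := isLeviCivita_leviCivita_holds (g := g)
  set c : ℝ → N := curveThrough I' z w with hc_def
  set x : ℝ → ℝ → M := fun τ s ↦ F (c s, τ) with hx_def
  -- regularity at `(t, 0)`
  have h2le : (2 : ℕ∞ω) ≤ ∞ := WithTop.coe_le_coe.2 le_top
  have hx2 : ContMDiffAt (𝓘(ℝ, ℝ).prod 𝓘(ℝ, ℝ)) I 2 (uncurry x) (t, 0) :=
    contMDiffAt_uncurry_family_curveThrough hF w
  have hT2 : ContMDiffAt (𝓘(ℝ, ℝ).prod 𝓘(ℝ, ℝ)) I.tangent 2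
      (fun q : ℝ × ℝ ↦ (TotalSpace.mk' E (x q.1 q.2) (velocity I (fun τ' ↦ x τ' q.2) q.1) :
        TangentBundle I M)) (t, 0) :=
    (contMDiffAt_lift_velocity_family_curveThrough hF w).of_le h2le
  -- the fields along the `t`-curve `τ ↦ x τ 0`: `V = D_s T`, `W = S`
  have hV : MDifferentiableAt 𝓘(ℝ, ℝ) I.tangent (fun τ' ↦ (TotalSpace.mk' E (x τ' 0)
      (covariantDerivAlong cov (x τ') (fun s ↦ velocity I (fun τ'' ↦ x τ'' s) τ') 0) :
        TangentBundle I M)) t :=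
    mdifferentiableAt_lift_covariantDerivAlong_curry_right cov hcov₁ hx2 hT2
  have hW : MDifferentiableAt 𝓘(ℝ, ℝ) I.tangent (fun τ' ↦ (TotalSpace.mk' E (x τ' 0)
      (velocity I (x τ') 0) : TangentBundle I M)) t :=
    mdifferentiableAt_lift_velocity_curry_right hx2
  have hprod := g.hasDerivAt_val_apply_along hLC.2 hV hW
  -- (1) `D_t S = D_s T`
  have hsymm : covariantDerivAlong cov (fun τ' ↦ x τ' 0) (fun τ' ↦ velocity I (x τ') 0) t =
      covariantDerivAlong cov (x t) (fun s ↦ velocity I (fun τ' ↦ x τ' s) t) 0 :=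
    covariantDerivAlong_velocity_comm cov hLC.1 hx2
  -- (2) `D_t (D_s T) = R(T, S) T`
  have hcurv := covariantDerivAlong_covariantDerivAlong_sub_eq_curvature (cov := cov) hcov₁
    (x := x) (Z := fun τ' s ↦ velocity I (fun τ'' ↦ x τ'' s) τ') (t := t) (s := 0) hx2 hT2
  beta_reduce at hcurv
  have hgeo_ev : ∀ᶠ s in 𝓝 (0 : ℝ), covariantDerivAlong cov (fun τ' ↦ x τ' s)
      (fun τ' ↦ velocity I (fun τ'' ↦ x τ'' s) τ') t = 0 := by
    have hcont : ContinuousAt c 0 := (contMDiffAt_curveThrough_zero (n := ∞) z w).continuousAt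
    have h0 : c 0 = z := curveThrough_zero I' z w
    have hev : ∀ᶠ s in 𝓝 (0 : ℝ), c s ∈ {y : N | covariantDerivAlong cov (fun τ ↦ F (y, τ))
        (fun τ ↦ velocity I (fun τ' : ℝ ↦ F (y, τ')) τ) t = 0} :=
      hcont.eventually (show ∀ᶠ y in 𝓝 (c 0), _ from by rw [h0]; exact hgeo)
    filter_upwards [hev] with s hs
    exact hs
  have hzero : covariantDerivAlong cov (x t)
      (fun s' ↦ covariantDerivAlong cov (fun τ' ↦ x τ' s')
        (fun τ' ↦ velocity I (fun τ'' ↦ x τ'' s') τ') t) 0 = 0 := by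
    have h := covariantDerivAlong_congr_of_eventuallyEq cov (γ := x t) (γ' := x t)
      (W := fun s' ↦ (0 : TangentSpace I (x t s')))
      (W' := fun s' ↦ covariantDerivAlong cov (fun τ' ↦ x τ' s')
        (fun τ' ↦ velocity I (fun τ'' ↦ x τ'' s') τ') t) (t₀ := 0)
      (by filter_upwards [hgeo_ev] with s' hs'; rw [hs'])
    rw [h]
    exact covariantDerivAlong_zero_field cov (x t) 0
  rw [hzero, sub_zero] at hcurv
  refine hprod.congr_deriv ?_
  rw [hcurv, hsymm]

omit [FiniteDimensional ℝ E] [CompleteSpace E] [Fact (1 ≤ n)] [FiniteDimensional ℝ E']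
  [I'.Boundaryless] [IsManifold I' ∞ N] in
/-- Transport of a curvature pairing `g_p(R_p(a, b) a, b)` along an equality of base points (all
four vectors read in the model space `E`). [folklore] -/
theorem val_curvature_congr_point {p p' : M} (h : p = p') (a b : E) :
    g.val p (g.leviCivita.curvature p (show TangentSpace I p from a) (show TangentSpace I p from b)
        (show TangentSpace I p from a)) (show TangentSpace I p from b) =
      g.val p' (g.leviCivita.curvature p' (show TangentSpace I p' from a)
        (show TangentSpace I p' from b) (show TangentSpace I p' from a))
        (show TangentSpace I p' from b) := by
  subst h; rfl

/-- **Evolution of the second fundamental forms of the level maps along geodesic `t`-curves**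
(the untraced Riccati equation; O'Neill 1983, Ch. 8, Lemma 8.3; Bär–Gauduchon–Moroianu 2005,
§4): if `F` is `C^∞` near `(z, t)` and the `t`-curves are geodesics at time `t` near `z`, then
for `w ∈ T_zN` the function `τ ↦ K_τ(w, w)` — `K_τ` the second fundamental form of `F_τ` w.r.t.
the variation field `T_τ = ∂_t F(·, τ)` — has derivative
`g(R(T_t z, dF_t w) T_t z, dF_t w) + g(D_w T_t, D_w T_t)` at `τ = t`
(`D_w T_t = normalDerivAlong F_t T_t z w`). [cite: ONeill1983, Ch. 8, Lemma 8.3 (proof)] -/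
theorem hasDerivAt_secondFundamentalForm_self_family (hcov₁ : g.leviCivita.IsLocallyContMDiff 1)
    (hF : ∀ᶠ q in 𝓝 (z, t), ContMDiffAt (I'.prod 𝓘(ℝ, ℝ)) I ∞ F q)
    (hgeo : ∀ᶠ y in 𝓝 z, covariantDerivAlong g.leviCivita (fun τ ↦ F (y, τ))
      (fun τ ↦ velocity I (fun τ' : ℝ ↦ F (y, τ')) τ) t = 0)
    (w : TangentSpace I' z) :
    HasDerivAt (fun τ ↦ g.secondFundamentalForm I' (fun y : N ↦ F (y, τ))
        (fun y ↦ velocity I (fun s : ℝ ↦ F (y, s)) τ) z w w)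
      (g.val (F (z, t))
          (g.leviCivita.curvature (F (z, t)) (velocity I (fun τ' : ℝ ↦ F (z, τ')) t)
            (mfderiv I' I (fun y : N ↦ F (y, t)) z w) (velocity I (fun τ' : ℝ ↦ F (z, τ')) t))
          (mfderiv I' I (fun y : N ↦ F (y, t)) z w) +
        g.val (F (z, t))
          (g.normalDerivAlong (fun y : N ↦ F (y, t)) (fun y ↦ velocity I (fun s : ℝ ↦ F (y, s)) t)
            z w)
          (g.normalDerivAlong (fun y : N ↦ F (y, t)) (fun y ↦ velocity I (fun s : ℝ ↦ F (y, s)) t)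
            z w)) t := by
  have hmain := hasDerivAt_secondVariation_family g hcov₁ hF hgeo w
  have hev := eventually_secondFundamentalForm_self_eq_family g hF w
  refine (hmain.congr_of_eventuallyEq hev).congr_deriv ?_
  -- transport from the base point `F (c 0, t)` to `F (z, t)`
  have h0 : curveThrough I' z w 0 = z := curveThrough_zero I' z w
  have hp : F (curveThrough I' z w 0, t) = F (z, t) := by rw [h0]
  have hT : (velocity I (fun τ' : ℝ ↦ F (curveThrough I' z w 0, τ')) t : E) =
      velocity I (fun τ' : ℝ ↦ F (z, τ')) t := by rw [h0]
  have hS : (velocity I (fun s ↦ F (curveThrough I' z w s, t)) 0 : E) =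
      mfderiv I' I (fun y : N ↦ F (y, t)) z w := velocity_family_curveThrough (contMDiffAt_level hF) w
  rw [val_curvature_congr_point g hp, val_congr_point (g := g) hp]
  -- all vectors now live over `F (z, t)`; rewrite them in the model space
  show g.val (F (z, t)) (g.leviCivita.curvature (F (z, t))
      (velocity I (fun τ' : ℝ ↦ F (curveThrough I' z w 0, τ')) t : E)
      (velocity I (fun s ↦ F (curveThrough I' z w s, t)) 0 : E)
      (velocity I (fun τ' : ℝ ↦ F (curveThrough I' z w 0, τ')) t : E))
      (velocity I (fun s ↦ F (curveThrough I' z w s, t)) 0 : E) + _ = _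
  rw [hT, hS]
  rfl

end Literature.Geometry.Riemannian
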